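import Literature.IUT.LogThetaLattice.LogLink
import Literature.IUT.LogThetaLattice.StripFrameWitness
import Mathlib.CategoryTheory.Category.ULift
import Mathlib.CategoryTheory.InducedCategory
import Mathlib.CategoryTheory.Discrete.Basic
import Mathlib.CategoryTheory.Functor.Const
import Mathlib.Logic.Equiv.Nat
import Mathlib.Data.Fintype.Card
import HarnessLib

/-!
# [IUTchIII] Prop 1.2 (x) — NON-VACUITY of the Frobenius-picture interface `FrobeniusChain` (NV-L6 wave, row «NV-L6/FrobeniusChain»)

Mochizuki, *Inter-universal Teichmüller Theory III*, kurims manuscript (May 2020), Prop 1.2 (x) p. 34: "a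
collection of DISTINCT `F`-prime-strips … indexed by the integers" `{ⁿF}_{n∈ℤ}` joined by full log-links.
PROOF-ONLY companion (no `def`, no `instance`, no `structure`) of `LogLink.lean` (abc-iut-L6-t3:
`FrobeniusChain (S : StripFrame)` = `(F : ℤ → S.F, injective)`). abc-iut-w5-d114's INHABITATION CENSUS v3 (§A)
lists `FrobeniusChain` with ZERO producers; this file records, kernel-checked:

* `FrobeniusChain.nonempty_iff_infinite` — the EXACT criterion: a frame carries a Frobenius-picture chain iff it
  has infinitely many `F`-prime-strips (a chain is literally an injection `ℤ ↪ S.F`; conversely `ℤ ≃ ℕ ↪ S.F`);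
  `nonempty_of_injective`, `isEmpty_of_finite`;
* `FrobeniusChain.isEmpty_twoFrame` — NEGATIVE at abc-iut-L6-t3's landed WITNESS frame `Witness.twoFrame`
  (ONE `F`-prime-strip: the one-object groupoid on `ℤˣ`): that frame, which inhabits the §1–§2 interface laws
  (`StripFrameWitness.lean`), carries NO Frobenius-picture chain — so every theorem of `LogLink.lean` quantified
  over `P : FrobeniusChain S` was, before this file, uninstantiated at every landed frame;
* `FrobeniusChain.nonempty_iff_of_F_eq_asSmall` — the GENUINE-frame criterion, stated generically: if
  `S.F = AsSmall Y` (as for the frame ASSEMBLED FROM THE [IUTchI] KITS, abc-iut-L6-t3's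
  `(StripFrame.ofKits L hbij hsurj hR X).F = AsSmall FK.FStrip` by `rfl`, abc-iut-L5-t4's `ℱ`-prime-strips), then
  the frame carries a chain iff `Y` is infinite — no kit hypothesis is re-bound here;
* `FrobeniusChain.nonempty_degenerate` — a DEGENERATE frame that DOES carry a chain, built inside the proof term:
  every prime-strip category := `ℤ` copies of the one-object groupoid on `ℤˣ` (Mathlib `InducedCategory` along
  the constant map `ℤ → Witness.Pt`; all objects isomorphic, all structure functors identities), Hodge theaters
  `Discrete (ℤ × ℤ)`, `D`-Hodge theaters `Discrete PUnit`; it also carries `LogStripData` (`log := 𝟭`), so the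
  chain's full log-links `FrobeniusChain.link` and Prop 1.2 (x)'s `inducedD_link_full` / `core_nonempty_iso`
  are instantiated (`link_instantiated_degenerate`).

HONEST LABEL (L6-lead §F v1.18p (4)): `nonempty_degenerate` is a TOY (distinct labels `n ∈ ℤ` on one
isomorphism class — which is, structurally, what Prop 1.2 (x) asks: distinct strips, all mutually isomorphic);
the genuine instance at `StripFrame.ofKits` is CONDITIONAL on `Infinite FK.FStrip` (abc-iut-L5-t4's kit has
infinitely many `ℱ`-prime-strip objects), which this file does not decide. Nothing of [IUTchIII] is asserted; a
witness is consistency evidence only. [claim: Mochizuki2012, status: disputed]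
-/

namespace Literature.IUT.LogThetaLattice

open CategoryTheory Literature.IUT.HodgeTheaters

universe u

namespace FrobeniusChain

variable {S : StripFrame.{u}}

/-- **IUTchIII:Prop1.2(x)** (kurims p.34) Any injective `ℤ`-indexed family of `F`-prime-strips is a Frobenius-picture
chain (the record has no further field). [claim: Mochizuki2012, status: disputed] -/
theorem nonempty_of_injective (f : ℤ → S.F) (hf : Function.Injective f) : Nonempty (FrobeniusChain S) :=
  ⟨⟨f, hf⟩⟩

/-- **IUTchIII:Prop1.2(x)** (kurims p.34) A frame carrying a Frobenius-picture chain has infinitely many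
`F`-prime-strips ("distinct … indexed by the integers"). [claim: Mochizuki2012, status: disputed] -/
theorem infinite_of_nonempty (h : Nonempty (FrobeniusChain S)) : Infinite S.F := by
  obtain ⟨P⟩ := h
  exact Infinite.of_injective P.F P.injective

/-- **IUTchIII:Prop1.2(x)** (kurims p.34) **EXACT CRITERION**: a frame carries a Frobenius-picture chain iff its
`F`-prime-strips form an infinite type (`ℤ ≃ ℕ ↪ S.F`). [claim: Mochizuki2012, status: disputed] -/
theorem nonempty_iff_infinite (S : StripFrame.{u}) : Nonempty (FrobeniusChain S) ↔ Infinite S.F := by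
  refine ⟨infinite_of_nonempty, fun h => ?_⟩
  haveI := h
  exact nonempty_of_injective (fun n => Infinite.natEmbedding S.F (Equiv.intEquivNat n))
    ((Infinite.natEmbedding S.F).injective.comp Equiv.intEquivNat.injective)

/-- **IUTchIII:Prop1.2(x)** (kurims p.34) A frame with finitely many `F`-prime-strips carries NO Frobenius-picture
chain. [claim: Mochizuki2012, status: disputed] -/
theorem isEmpty_of_finite [Finite S.F] : IsEmpty (FrobeniusChain S) :=
  ⟨fun P => not_injective_infinite_finite P.F P.injective⟩

/-- **IUTchIII:Prop1.2(x)** (kurims p.34) NEGATIVE at the landed witness frame: abc-iut-L6-t3's `Witness.twoFrame`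
(every prime-strip category = the ONE-object groupoid `Witness.Pt` on `ℤˣ`) carries NO Frobenius-picture chain —
it has a single `F`-prime-strip. [claim: Mochizuki2012, status: disputed] -/
theorem isEmpty_twoFrame : IsEmpty (FrobeniusChain Witness.twoFrame) := by
  haveI : Finite Witness.twoFrame.F := inferInstanceAs (Finite (Quiver.SingleObj ℤˣ))
  exact isEmpty_of_finite

/-- **IUTchIII:Prop1.2(x)** (kurims p.34) GENUINE-frame criterion, stated generically: if the frame's category of
`F`-prime-strips is (definitionally) the small model `AsSmall Y` of a category `Y` — as for abc-iut-L6-t3's frame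
ASSEMBLED FROM THE [IUTchI] KITS, `(StripFrame.ofKits L hbij hsurj hR X).F = AsSmall FK.FStrip` by `rfl` — then the
frame carries a Frobenius-picture chain iff `Y` is infinite (instantiate with `h := rfl`; no kit hypothesis is
re-bound here). [claim: Mochizuki2012, status: disputed] -/
theorem nonempty_iff_of_F_eq_asSmall {Y : Type u} [Category.{u} Y] {S : StripFrame.{max 1 u}}
    (h : S.F = AsSmall.{max 1 u} Y) : Nonempty (FrobeniusChain S) ↔ Infinite Y := by
  rw [nonempty_iff_infinite, h]
  exact Equiv.ulift.infinite_iff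

/-- **IUTchIII:Prop1.2(x)** (kurims p.34) DEGENERATE WITNESS (built inside the proof term; no declaration added):
the frame whose every prime-strip category is `ℤ` labelled copies of the one-object groupoid `Witness.Pt` on `ℤˣ`
(`InducedCategory Witness.Pt (fun _ : ℤ => Witness.pt)`: all objects mutually isomorphic, all structure functors
identities; Hodge theaters `Discrete (ℤ × ℤ)`, `D`-Hodge theaters `Discrete PUnit`) satisfies EVERY `StripFrame`
law, carries the Frobenius-picture chain `n ↦ ⁿF := n`, carries `LogStripData` (`log := 𝟭`), and has infinitely
many `F`-prime-strips. Degenerate: one isomorphism class with distinct labels — structurally what Prop 1.2 (x)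
asks ("distinct", all `F`-prime-strips being mutually isomorphic, `StripFrame.iso_nonempty_F`).
[claim: Mochizuki2012, status: disputed] -/
theorem nonempty_degenerate :
    ∃ S : StripFrame.{0}, Nonempty (FrobeniusChain S) ∧ Nonempty (LogStripData S) ∧ Infinite S.F := by
  let Z : Type := InducedCategory Witness.Pt (fun _ : ℤ => Witness.pt)
  have hbij : ∀ X Y : Z, Function.Bijective (fun f : X ≅ Y => (𝟭 Z).mapIso f) := fun X Y =>
    ⟨fun f g hfg => Iso.ext (congrArg Iso.hom hfg), fun e => ⟨e, Iso.ext rfl⟩⟩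
  have hiso : ∀ X Y : Z, Nonempty (X ≅ Y) := fun X Y => ⟨InducedCategory.isoMk (Iso.refl _)⟩
  let S : StripFrame.{0} :=
    { F := Z, Fv := Z, Fxm := Z, Fvtxm := Z, Fgl := Z, Fglxm := Z, D := Z, Dv := Z
      HT := Discrete (ℤ × ℤ)
      DHT := Discrete PUnit
      toD := 𝟭 Z, toFv := 𝟭 Z, FvToDv := 𝟭 Z, DToDv := 𝟭 Z, FvToFxm := 𝟭 Z, FxmToDv := 𝟭 Z
      FglToFv := 𝟭 Z, FglToFglxm := 𝟭 Z, FglxmToFvtxm := 𝟭 Z, FvtxmToFxm := 𝟭 Z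
      toDv_comm := Iso.refl _
      fxm_comm := Iso.refl _
      htToD := (Functor.const _).obj ⟨PUnit.unit⟩
      Label := PUnit
      strip := fun _ => (Functor.const _).obj ((0 : ℤ) : Z)
      dstrip := fun _ => (Functor.const _).obj ((0 : ℤ) : Z)
      strip_comm := fun _ => NatIso.ofComponents (fun _ => Iso.refl _) (fun _ => rfl)
      toD_isoBij := hbij
      toDv_isoSurj := fun X Y => (hbij X Y).2
      iso_nonempty_F := hiso
      iso_nonempty_Fxm := hiso
      iso_nonempty_Fglxm := hiso
      iso_nonempty_DHT := fun X Y => ⟨eqToIso (Subsingleton.elim X Y)⟩ }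
  refine ⟨S, ⟨⟨fun n : ℤ => (n : Z), fun _ _ h => h⟩⟩, ⟨⟨𝟭 Z, Iso.refl _⟩⟩, ?_⟩
  exact Infinite.of_injective (fun n : ℤ => (n : Z)) fun _ _ h => h

/-- **IUTchIII:Prop1.2(x)** (kurims p.34) … hence the chain's data of Prop 1.2 (x) are instantiated somewhere: there
are a frame, log-strip data and a chain for which the full log-links `ⁿF --log--> ⁿ⁺¹F` (landed `FrobeniusChain.link`)
exist and induce the FULL `D`-poly-isomorphisms with a nonempty core (landed `inducedD_link_full`,
`core_nonempty_iso`, abc-iut-L6-t3). [claim: Mochizuki2012, status: disputed] -/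
theorem link_instantiated_degenerate :
    ∃ (S : StripFrame.{0}) (L : LogStripData S) (P : FrobeniusChain S),
      (∀ n : ℤ, (P.link L n).inducedD = PolyIso.full _ _) ∧
        ∀ n m : ℤ, Nonempty (S.toD.obj (P.F n) ≅ S.toD.obj (P.F m)) := by
  obtain ⟨S, ⟨P⟩, ⟨L⟩, -⟩ := nonempty_degenerate
  exact ⟨S, L, P, P.inducedD_link_full L, P.core_nonempty_iso⟩

end FrobeniusChain

end Literature.IUT.LogThetaLattice
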